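import Literature.RepresentationTheory.ModularTensorCategories.SU2FUnitaryKL
import Literature.RepresentationTheory.ModularTensorCategories.SU2FUnit
import Literature.Analysis.SpecialFunctions.QRacahSumRecurrence
import Mathlib.Analysis.SpecialFunctions.Trigonometric.Basic
import Mathlib.Analysis.Complex.Exponential

/-!
# The Kauffman–Lins Racah sum at `q = e^{iπ/(k+2)}`: bridge to the generic three-term recurrence

Topic `Literature/RepresentationTheory/ModularTensorCategories` (toward `KLOrthogonality_holds`, the
orthogonality of the Kauffman–Lins `q`-6j symbols, KL94 §7.3 Prop. 9). This file specialises the generic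
creative-telescoping recurrence `Literature.Analysis.SpecialFunctions.racahW_threeTerm` of the Racah sum to the
root of unity `p = e^{iπ/(k+2)}` and to Kauffman–Lins' labels:

* `klP k = e^{iπ/(k+2)}`; `qBr (klP k) n = [n]` (`qBr_klP_natCast`), `qFac (klP k) n = [n]!` (`qFac_klP`), and
  `[m] ≠ 0` for `1 ≤ m ≤ k+1` (`qBr_klP_ne_zero`);
* `racahSum_eq_racahW` — the real Racah sum `racahSum k a b j c d i` of `SU2LevelK.lean` (the alternating sum
  of `Tet[a b i; c d j]`, `tetNet_eq`) is the window sum `racahW` of `QRacahSumRecurrence.lean` at `p = klP k`, for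
  TRIANGLE-admissible triads (no level condition needed);
* `racahSum_threeTerm` — the three-term recurrence in `j`, AS REAL NUMBERS, for level-`k` admissible
  `(a,d,i), (b,c,i), (a,b,j), (c,d,j)`:
  `[j][j+1][j+2]·E_i·S(j) = [j]·D̂_j·S(j+2) + ([j]Â_j + [j+2]Ĉ_j)·S(j) + [j+2]·C̃_j·S(j-2)`,
  `S(j') = racahSum k a b j' c d i` (with `S(j±2) := 0` when `j±2` breaks a triangle), `E_i = [(d+i-a)/2][(a+i-d)/2+1]`.
The division by `[j][j+1][j+2]`, the corner rows `j = 0`, `j = k`, the symmetric kernel and the orthogonality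
itself are in the sequel files. [cite: KauffmanLins1994, §9.11 (Tet), §7.3 Prop. 9]
[cite: GasperRahman2004, §7.2 eq. (7.2.1)]
-/

noncomputable section

namespace Literature.RepresentationTheory.ModularTensorCategories.SU2LevelK

open Finset Complex Literature.Analysis.SpecialFunctions

variable (k : ℕ)

/-! ### The root of unity `p = e^{iπ/(k+2)}` and the quantum integers -/

/-- `p = e^{iθ}`, `θ = π/(k+2)` (so `q = p² = e^{iπ/r·2}`, Kauffman–Lins' `A²`... conventions aside, `[n] = sin nθ/sin θ`).
[cite: KauffmanLins1994, §9.4] -/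
def klP : ℂ := Complex.exp (((Real.pi / (k + 2) : ℝ) : ℂ) * I)

/-- `p ≠ 0`. [folklore] -/
theorem klP_ne_zero : klP k ≠ 0 := Complex.exp_ne_zero _

/-- `pᵐ = e^{imθ}`. [folklore] -/
theorem klP_zpow (m : ℤ) : klP k ^ m = Complex.exp ((((m : ℝ) * (Real.pi / (k + 2)) : ℝ) : ℂ) * I) := by
  unfold klP
  rw [← Complex.exp_int_mul]
  congr 1
  push_cast
  ring

/-- `e^{ix} - e^{-ix} = 2i sin x` (real `x`). [folklore] -/
theorem cexp_sub_cexp_neg (x : ℝ) :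
    Complex.exp ((x : ℂ) * I) - Complex.exp ((((-x : ℝ)) : ℂ) * I) = 2 * I * (Real.sin x : ℂ) := by
  rw [Complex.ofReal_sin, Complex.sin]
  push_cast
  ring_nf
  rw [I_sq]
  ring

/-- `qBr p m = [m]_θ = sin(mθ)/sin θ` at `p = e^{iθ}`, `θ = π/(k+2)`, for all `m ∈ ℤ`. [cite: KauffmanLins1994, §9.4] -/
theorem qBr_klP (m : ℤ) :
    qBr (klP k) m = ((Real.sin (m * (Real.pi / (k + 2))) / Real.sin (Real.pi / (k + 2)) : ℝ) : ℂ) := by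
  unfold qBr
  have h1 : klP k ^ m - klP k ^ (-m) = 2 * I * (Real.sin (m * (Real.pi / (k + 2))) : ℂ) := by
    rw [klP_zpow, klP_zpow, ← cexp_sub_cexp_neg]
    push_cast
    ring_nf
  have h2 : klP k - (klP k)⁻¹ = 2 * I * (Real.sin (Real.pi / (k + 2)) : ℂ) := by
    have := cexp_sub_cexp_neg (Real.pi / (k + 2))
    unfold klP
    rw [← Complex.exp_neg]
    convert this using 2
    push_cast
    ring
  rw [h1, h2, mul_div_mul_left _ _ (mul_ne_zero two_ne_zero I_ne_zero)]
  push_cast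
  rfl

/-- `qBr p n = [n]` (`= qInt k n`) for `n : ℕ`. [cite: KauffmanLins1994, §9.4] -/
theorem qBr_klP_natCast (n : ℕ) : qBr (klP k) (n : ℤ) = (qInt k n : ℂ) := by
  rw [qBr_klP]
  unfold qInt
  push_cast
  ring_nf

/-- `qFac p n = [n]!` (`= qFactorial k n`). [cite: KauffmanLins1994, §9.4] -/
theorem qFac_klP (n : ℕ) : qFac (klP k) n = (qFactorial k n : ℂ) := by
  unfold qFac qFactorial
  push_cast
  refine prod_congr rfl fun s _ => ?_
  exact_mod_cast qBr_klP_natCast k (s + 1)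

/-- `[m] ≠ 0` at `p = e^{iπ/(k+2)}` for `1 ≤ m ≤ k+1`. [cite: KauffmanLins1994, §9.4] -/
theorem qBr_klP_ne_zero {m : ℤ} (h1 : 1 ≤ m) (h2 : m ≤ k + 1) : qBr (klP k) m ≠ 0 := by
  obtain ⟨n, rfl⟩ : ∃ n : ℕ, m = n := ⟨m.toNat, by omega⟩
  rw [qBr_klP_natCast]
  exact_mod_cast (qInt_pos k (by exact_mod_cast h1) (by exact_mod_cast h2)).ne'

/-- `[n]! ≠ 0` at `p = e^{iπ/(k+2)}` for `n ≤ k+1`. [folklore] -/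
theorem qFac_klP_ne_zero {n : ℕ} (h : n ≤ k + 1) : qFac (klP k) n ≠ 0 := by
  rw [qFac_klP]
  exact_mod_cast (qFactorial_pos k h).ne'

/-! ### The Racah sum of `SU2LevelK.lean` as a window sum `racahW` -/

/-- A triad satisfying parity and the triangle inequalities (admissibility without the level condition).
[cite: KauffmanLins1994, §9.9 (admissible triples)] -/
def Tri (a b c : ℕ) : Prop := (a + b + c) % 2 = 0 ∧ c ≤ a + b ∧ a ≤ b + c ∧ b ≤ c + a

/-- `Tri` is decidable. [folklore] -/
instance instDecidableTri (a b c : ℕ) : Decidable (Tri a b c) := by unfold Tri; infer_instance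

/-- Level-`k` admissibility is `Tri` plus `a + b + c ≤ 2k`. [cite: KauffmanLins1994, §9.9] -/
theorem adm_iff_tri {a b c : ℕ} : Adm k a b c ↔ Tri a b c ∧ a + b + c ≤ 2 * k := by
  unfold Adm Tri; tauto

/-- One term of the real Racah sum equals `racahTerm` at `p = e^{iπ/(k+2)}` inside the support.
[cite: KauffmanLins1994, §9.11] -/
theorem racahTerm_klP_eq {α₁ α₂ α₃ α₄ β₁ β₂ β₃ s : ℕ} (h1 : α₁ ≤ s) (h2 : α₂ ≤ s) (h3 : α₃ ≤ s) (h4 : α₄ ≤ s)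
    (k1 : s ≤ β₁) (k2 : s ≤ β₂) (k3 : s ≤ β₃) :
    racahTerm (klP k) α₁ α₂ α₃ α₄ β₁ β₂ β₃ s =
      (((-1 : ℝ) ^ s * qFactorial k (s + 1) /
          (qFactorial k (s - α₁) * qFactorial k (s - α₂) * qFactorial k (s - α₃) * qFactorial k (s - α₄) *
            qFactorial k (β₁ - s) * qFactorial k (β₂ - s) * qFactorial k (β₃ - s)) : ℝ) : ℂ) := by
  unfold racahTerm
  rw [qInvFac_of_nonneg _ (by omega : (0 : ℤ) ≤ s - α₁), qInvFac_of_nonneg _ (by omega : (0 : ℤ) ≤ s - α₂),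
    qInvFac_of_nonneg _ (by omega : (0 : ℤ) ≤ s - α₃), qInvFac_of_nonneg _ (by omega : (0 : ℤ) ≤ s - α₄),
    qInvFac_of_nonneg _ (by omega : (0 : ℤ) ≤ β₁ - s), qInvFac_of_nonneg _ (by omega : (0 : ℤ) ≤ β₂ - s),
    qInvFac_of_nonneg _ (by omega : (0 : ℤ) ≤ β₃ - s),
    show ((s : ℤ) - α₁).toNat = s - α₁ by omega, show ((s : ℤ) - α₂).toNat = s - α₂ by omega,
    show ((s : ℤ) - α₃).toNat = s - α₃ by omega, show ((s : ℤ) - α₄).toNat = s - α₄ by omega,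
    show ((β₁ : ℤ) - s).toNat = β₁ - s by omega, show ((β₂ : ℤ) - s).toNat = β₂ - s by omega,
    show ((β₃ : ℤ) - s).toNat = β₃ - s by omega, show ((s : ℤ) + 1).toNat = s + 1 by omega,
    zpow_natCast]
  simp only [qFac_klP]
  push_cast
  ring

/-- The Racah alternating sum over its support (in the factor order of `racahSum`) is the generic window sum
`racahW` at `p = e^{iπ/(k+2)}` on the window `α₁ ≤ z ≤ β₃` — for ALL `α, β ∈ ℕ` (both sides vanish termwise
off the support). [cite: KauffmanLins1994, §9.11] -/
theorem racahIcc_eq_racahW (α₁ α₂ α₃ α₄ β₁ β₂ β₃ : ℕ) :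
    ((∑ s ∈ Icc (max (max α₃ α₄) (max α₂ α₁)) (min (min β₃ β₂) β₁),
        (-1 : ℝ) ^ s * qFactorial k (s + 1) /
          (qFactorial k (s - α₃) * qFactorial k (s - α₄) * qFactorial k (s - α₂) * qFactorial k (s - α₁) *
            qFactorial k (β₃ - s) * qFactorial k (β₂ - s) * qFactorial k (β₁ - s)) : ℝ) : ℂ) =
      racahW (klP k) α₁ α₂ α₃ α₄ β₁ β₂ β₃ α₁ (β₃ + 1 - α₁) := by
  unfold racahW
  set f : ℕ → ℂ := fun s => racahTerm (klP k) α₁ α₂ α₃ α₄ β₁ β₂ β₃ s with hf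
  have hwin : ∑ n ∈ range (β₃ + 1 - α₁), racahTerm (klP k) α₁ α₂ α₃ α₄ β₁ β₂ β₃ ((α₁ : ℤ) + (n : ℕ)) =
      ∑ s ∈ Ico α₁ (β₃ + 1), f s := by
    rw [sum_Ico_eq_sum_range]
    refine sum_congr rfl fun n _ => ?_
    rw [hf]
    push_cast
    ring_nf
  have hsub : Icc (max (max α₃ α₄) (max α₂ α₁)) (min (min β₃ β₂) β₁) ⊆ Ico α₁ (β₃ + 1) := by
    intro s hs
    rw [mem_Icc] at hs
    rw [mem_Ico]
    omega
  have hzero : ∀ s ∈ Ico α₁ (β₃ + 1), s ∉ Icc (max (max α₃ α₄) (max α₂ α₁)) (min (min β₃ β₂) β₁) →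
      f s = 0 := by
    intro s _ hs
    rw [mem_Icc, not_and_or, not_le, not_le] at hs
    rw [hf]
    rcases hs with hs | hs
    · exact racahTerm_eq_zero_of_lt _ (by omega)
    · exact racahTerm_eq_zero_of_gt _ (by omega)
  rw [hwin, ← sum_subset hsub hzero]
  push_cast
  refine sum_congr rfl fun s hs => ?_
  rw [mem_Icc] at hs
  obtain ⟨hs1, hs2⟩ := hs
  rw [hf]
  simp only
  rw [racahTerm_klP_eq k (by omega) (by omega) (by omega) (by omega) (by omega) (by omega) (by omega)]
  push_cast
  ring

/-- **The real Racah sum is the generic window sum at `p = e^{iπ/(k+2)}`**: with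
`α = ((a+d+i)/2, (b+c+i)/2, (a+b+j)/2, (c+d+j)/2)`, `β = ((b+d+i+j)/2, (a+c+i+j)/2, (a+b+c+d)/2)` and the window
`α₁ ≤ z ≤ β₃`, `racahSum k a b j c d i = W(α;β)` (all labels; no admissibility needed). [cite: KauffmanLins1994, §9.11] -/
theorem racahSum_eq_racahW (a b c d i j : ℕ) :
    (racahSum k a b j c d i : ℂ) =
      racahW (klP k) ((a + d + i) / 2 : ℕ) ((b + c + i) / 2 : ℕ) ((a + b + j) / 2 : ℕ) ((c + d + j) / 2 : ℕ)
        ((b + d + i + j) / 2 : ℕ) ((a + c + i + j) / 2 : ℕ) ((a + b + c + d) / 2 : ℕ) ((a + d + i) / 2 : ℕ)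
        ((a + b + c + d) / 2 + 1 - (a + d + i) / 2) := by
  unfold racahSum
  simp only
  rw [show j + c + d = c + d + j by omega, show a + i + d = a + d + i by omega,
    show a + j + c + i = a + c + i + j by omega, show b + j + d + i = b + d + i + j by omega]
  exact racahIcc_eq_racahW k _ _ _ _ _ _ _


/-! ### The three-term recurrence for Kauffman–Lins labels, as real numbers -/

/-- A window sum `racahW` vanishes when the fourth lower index exceeds `β₃` (empty support). [folklore] -/
theorem racahW_eq_zero_of_lt₄ {K : Type*} [Field K] (p : K) {α₁ α₂ α₃ α₄ β₁ β₂ β₃ lo : ℤ} {N : ℕ}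
    (h : β₃ < α₄) : racahW p α₁ α₂ α₃ α₄ β₁ β₂ β₃ lo N = 0 := by
  unfold racahW
  refine sum_eq_zero fun n _ => ?_
  by_cases hz : lo + n ≤ β₃
  · exact racahTerm_eq_zero_of_lt p (Or.inr (Or.inr (Or.inr (by omega))))
  · exact racahTerm_eq_zero_of_gt p (Or.inr (Or.inr (by omega)))

/-- A window sum `racahW` vanishes when the third lower index exceeds `β₃` (empty support). [folklore] -/
theorem racahW_eq_zero_of_lt₃ {K : Type*} [Field K] (p : K) {α₁ α₂ α₃ α₄ β₁ β₂ β₃ lo : ℤ} {N : ℕ}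
    (h : β₃ < α₃) : racahW p α₁ α₂ α₃ α₄ β₁ β₂ β₃ lo N = 0 := by
  unfold racahW
  refine sum_eq_zero fun n _ => ?_
  by_cases hz : lo + n ≤ β₃
  · exact racahTerm_eq_zero_of_lt p (Or.inr (Or.inr (Or.inl (by omega))))
  · exact racahTerm_eq_zero_of_gt p (Or.inr (Or.inr (by omega)))

/-- A window sum `racahW` vanishes when `β₁ < α₁` or `β₁ < α₂` or `β₂ < α₁` or `β₂ < α₂` (empty support).
[folklore] -/
theorem racahW_eq_zero_of_lt₁₂ {K : Type*} [Field K] (p : K) {α₁ α₂ α₃ α₄ β₁ β₂ β₃ lo : ℤ} {N : ℕ}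
    (h : β₁ < α₁ ∨ β₁ < α₂ ∨ β₂ < α₁ ∨ β₂ < α₂) : racahW p α₁ α₂ α₃ α₄ β₁ β₂ β₃ lo N = 0 := by
  unfold racahW
  refine sum_eq_zero fun n _ => ?_
  rcases h with h | h | h | h
  · by_cases hz : lo + n ≤ β₁
    · exact racahTerm_eq_zero_of_lt p (Or.inl (by omega))
    · exact racahTerm_eq_zero_of_gt p (Or.inl (by omega))
  · by_cases hz : lo + n ≤ β₁
    · exact racahTerm_eq_zero_of_lt p (Or.inr (Or.inl (by omega)))
    · exact racahTerm_eq_zero_of_gt p (Or.inl (by omega))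
  · by_cases hz : lo + n ≤ β₂
    · exact racahTerm_eq_zero_of_lt p (Or.inl (by omega))
    · exact racahTerm_eq_zero_of_gt p (Or.inr (Or.inl (by omega)))
  · by_cases hz : lo + n ≤ β₂
    · exact racahTerm_eq_zero_of_lt p (Or.inr (Or.inl (by omega)))
    · exact racahTerm_eq_zero_of_gt p (Or.inr (Or.inl (by omega)))

/-- The upper neighbour `S(j+2)` of the recurrence: the Racah sum with `j+2` when `(a,b,j+2), (c,d,j+2)` are still
triangles, else `0`. [cite: KauffmanLins1994, §9.11] -/
def racahSumUp (a b c d i j : ℕ) : ℝ :=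
  if Tri a b (j + 2) ∧ Tri c d (j + 2) then racahSum k a b (j + 2) c d i else 0

/-- The lower neighbour `S(j-2)` of the recurrence: the Racah sum with `j-2` when `j ≥ 2` and `(a,b,j-2), (c,d,j-2)`
are triangles, else `0`. [cite: KauffmanLins1994, §9.11] -/
def racahSumDown (a b c d i j : ℕ) : ℝ :=
  if 2 ≤ j ∧ Tri a b (j - 2) ∧ Tri c d (j - 2) then racahSum k a b (j - 2) c d i else 0

/-- The upper neighbour as a window sum (complex form): for triangle-admissible `(a,b,j), (c,d,j)`,
`racahSumUp = W(τ₊)` on the window `[α₁, β₃]` (it is the empty-support `0` when `j+2` breaks a triangle).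
[cite: KauffmanLins1994, §9.11] -/
theorem racahSumUp_coe {a b c d i j : ℕ} (habj : Tri a b j) (hcdj : Tri c d j) :
    (racahSumUp k a b c d i j : ℂ) =
      racahW (klP k) ↑((a + d + i) / 2) ↑((b + c + i) / 2) (↑((a + b + j) / 2) + 1) (↑((c + d + j) / 2) + 1)
        (↑((b + d + i + j) / 2) + 1) (↑((a + c + i + j) / 2) + 1) ↑((a + b + c + d) / 2) ↑((a + d + i) / 2)
        ((a + b + c + d) / 2 + 1 - (a + d + i) / 2) := by
  unfold Tri at habj hcdj
  unfold racahSumUp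
  split_ifs with h
  · have e := racahSum_eq_racahW k a b c d i (j + 2)
    rw [show (a + b + (j + 2)) / 2 = (a + b + j) / 2 + 1 by omega, show (c + d + (j + 2)) / 2 = (c + d + j) / 2 + 1 by omega,
      show (b + d + i + (j + 2)) / 2 = (b + d + i + j) / 2 + 1 by omega,
      show (a + c + i + (j + 2)) / 2 = (a + c + i + j) / 2 + 1 by omega] at e
    push_cast at e ⊢
    exact e
  · rw [Complex.ofReal_zero]
    unfold Tri at h
    rcases le_or_gt (j + 2) (a + b) with h1 | h1
    · rcases le_or_gt (j + 2) (c + d) with h2 | h2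
      · exact absurd ⟨⟨by omega, h1, by omega, by omega⟩, ⟨by omega, h2, by omega, by omega⟩⟩ h
      · exact (racahW_eq_zero_of_lt₃ _ (by omega)).symm
    · exact (racahW_eq_zero_of_lt₄ _ (by omega)).symm

/-- The lower neighbour as a window sum (complex form): for triangle-admissible `(a,d,i), (b,c,i), (a,b,j), (c,d,j)`,
`racahSumDown = W(τ₋)` on the window `[α₁, β₃]`. [cite: KauffmanLins1994, §9.11] -/
theorem racahSumDown_coe {a b c d i j : ℕ} (hadi : Tri a d i) (hbci : Tri b c i) (habj : Tri a b j)
    (hcdj : Tri c d j) :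
    (racahSumDown k a b c d i j : ℂ) =
      racahW (klP k) ↑((a + d + i) / 2) ↑((b + c + i) / 2) (↑((a + b + j) / 2) - 1) (↑((c + d + j) / 2) - 1)
        (↑((b + d + i + j) / 2) - 1) (↑((a + c + i + j) / 2) - 1) ↑((a + b + c + d) / 2) ↑((a + d + i) / 2)
        ((a + b + c + d) / 2 + 1 - (a + d + i) / 2) := by
  unfold Tri at hadi hbci habj hcdj
  unfold racahSumDown
  split_ifs with h
  · obtain ⟨h2, hab, hcd⟩ := h
    have e := racahSum_eq_racahW k a b c d i (j - 2)
    rw [show (((a + b + (j - 2)) / 2 : ℕ) : ℤ) = ↑((a + b + j) / 2) - 1 by omega,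
      show (((c + d + (j - 2)) / 2 : ℕ) : ℤ) = ↑((c + d + j) / 2) - 1 by omega,
      show (((b + d + i + (j - 2)) / 2 : ℕ) : ℤ) = ↑((b + d + i + j) / 2) - 1 by omega,
      show (((a + c + i + (j - 2)) / 2 : ℕ) : ℤ) = ↑((a + c + i + j) / 2) - 1 by omega] at e
    exact e
  · rw [Complex.ofReal_zero]
    unfold Tri at h
    symm
    apply racahW_eq_zero_of_lt₁₂
    omega

set_option maxHeartbeats 1600000 in
/-- **Three-term recurrence of the Kauffman–Lins Racah sum in `j`, as real numbers** (the `q`-Racah recurrence,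
G-R (7.2.1), in Racah-sum form, at `q = e^{iπ/(k+2)}`): for level-`k` admissible `(a,d,i), (b,c,i), (a,b,j), (c,d,j)`,
with `S(j) = racahSum k a b j c d i`,
`[j][j+1][j+2]·[(d+i-a)/2][(a+i-d)/2+1]·S(j) = [j]·D̂·S(j+2) + ([j]·Â + [j+2]·Ĉ)·S(j) + [j+2]·C̃·S(j-2)` with
`D̂ = [(b+j-a)/2+1][(d+j-c)/2+1][(c+j-d)/2+1][(a+j-b)/2+1]`, `Â = [(c+j-d)/2+1][(a+j-b)/2+1][(c+d-j)/2][(a+b+j)/2+2]`,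
`Ĉ = [(b+j-a)/2][(d+j-c)/2][(a+b-j)/2+1][(c+d+j)/2+1]`, `C̃ = [(a+b+j)/2+1][(c+d+j)/2+1][(c+d-j)/2+1][(a+b-j)/2+1]`.
[cite: KauffmanLins1994, §9.11] [cite: GasperRahman2004, §7.2 eq. (7.2.1)] -/
theorem racahSum_threeTerm {a b c d i j : ℕ} (hadi : Adm k a d i) (hbci : Adm k b c i) (habj : Adm k a b j)
    (hcdj : Adm k c d j) :
    qInt k j * qInt k (j + 1) * qInt k (j + 2) * (qInt k ((d + i - a) / 2) * qInt k ((a + i - d) / 2 + 1)) *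
        racahSum k a b j c d i =
      qInt k j * (qInt k ((b + j - a) / 2 + 1) * qInt k ((d + j - c) / 2 + 1) * qInt k ((c + j - d) / 2 + 1) *
          qInt k ((a + j - b) / 2 + 1)) * racahSumUp k a b c d i j +
      (qInt k j * (qInt k ((c + j - d) / 2 + 1) * qInt k ((a + j - b) / 2 + 1) * qInt k ((c + d - j) / 2) *
            qInt k ((a + b + j) / 2 + 2)) +
          qInt k (j + 2) * (qInt k ((b + j - a) / 2) * qInt k ((d + j - c) / 2) * qInt k ((a + b - j) / 2 + 1) *
            qInt k ((c + d + j) / 2 + 1))) * racahSum k a b j c d i +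
      qInt k (j + 2) * (qInt k ((a + b + j) / 2 + 1) * qInt k ((c + d + j) / 2 + 1) * qInt k ((c + d - j) / 2 + 1) *
          qInt k ((a + b - j) / 2 + 1)) * racahSumDown k a b c d i j := by
  have hadi' := hadi; have hbci' := hbci; have habj' := habj; have hcdj' := hcdj
  unfold Adm at hadi' hbci' habj' hcdj'
  -- the generic recurrence at `p = e^{iπ/(k+2)}`, `Mx = k+1`, window `[α₁, β₃]`
  have key := racahW_threeTerm (klP k) (klP_ne_zero k) (Mx := (k : ℤ) + 1)
    (α₁ := ((a + d + i) / 2 : ℕ)) (α₂ := ((b + c + i) / 2 : ℕ)) (α₃ := ((a + b + j) / 2 : ℕ))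
    (α₄ := ((c + d + j) / 2 : ℕ)) (β₁ := ((b + d + i + j) / 2 : ℕ)) (β₂ := ((a + c + i + j) / 2 : ℕ))
    (β₃ := ((a + b + c + d) / 2 : ℕ)) (lo := ((a + d + i) / 2 : ℕ)) (N := (a + b + c + d) / 2 + 1 - (a + d + i) / 2)
    (by omega) (fun m h1 h2 => qBr_klP_ne_zero k h1 h2) (by omega) le_rfl (by push_cast; omega)
    (by push_cast; omega) (by push_cast; omega) (by push_cast; omega) (by push_cast; omega) (by omega) (by omega)
    (by omega)
  -- the three window sums are the real Racah sums
  have hW : racahW (klP k) ↑((a + d + i) / 2) ↑((b + c + i) / 2) ↑((a + b + j) / 2) ↑((c + d + j) / 2)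
      ↑((b + d + i + j) / 2) ↑((a + c + i + j) / 2) ↑((a + b + c + d) / 2) ↑((a + d + i) / 2)
      ((a + b + c + d) / 2 + 1 - (a + d + i) / 2) = (racahSum k a b j c d i : ℂ) := (racahSum_eq_racahW k a b c d i j).symm
  have hWup := (racahSumUp_coe k (i := i) ((adm_iff_tri k).mp habj).1 ((adm_iff_tri k).mp hcdj).1).symm
  have hWdn := (racahSumDown_coe k ((adm_iff_tri k).mp hadi).1 ((adm_iff_tri k).mp hbci).1 ((adm_iff_tri k).mp habj).1
    ((adm_iff_tri k).mp hcdj).1).symm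
  have cj0 : qBr (klP k) (↑((b + d + i + j) / 2) + ↑((a + c + i + j) / 2) - ↑((a + d + i) / 2) - ↑((b + c + i) / 2)) = (qInt k (j) : ℂ) := by
    rw [show (↑((b + d + i + j) / 2) + ↑((a + c + i + j) / 2) - ↑((a + d + i) / 2) - ↑((b + c + i) / 2) : ℤ) = ((j : ℕ) : ℤ) by omega, qBr_klP_natCast]
  have cj1 : qBr (klP k) (↑((b + d + i + j) / 2) + ↑((a + c + i + j) / 2) - ↑((a + d + i) / 2) - ↑((b + c + i) / 2) + 1) = (qInt k (j + 1) : ℂ) := by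
    rw [show (↑((b + d + i + j) / 2) + ↑((a + c + i + j) / 2) - ↑((a + d + i) / 2) - ↑((b + c + i) / 2) + 1 : ℤ) = ((j + 1 : ℕ) : ℤ) by omega, qBr_klP_natCast]
  have cj2 : qBr (klP k) (↑((b + d + i + j) / 2) + ↑((a + c + i + j) / 2) - ↑((a + d + i) / 2) - ↑((b + c + i) / 2) + 2) = (qInt k (j + 2) : ℂ) := by
    rw [show (↑((b + d + i + j) / 2) + ↑((a + c + i + j) / 2) - ↑((a + d + i) / 2) - ↑((b + c + i) / 2) + 2 : ℤ) = ((j + 2 : ℕ) : ℤ) by omega, qBr_klP_natCast]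
  have cE1 : qBr (klP k) (↑((b + d + i + j) / 2) - ↑((a + b + j) / 2)) = (qInt k ((d + i - a) / 2) : ℂ) := by
    rw [show (↑((b + d + i + j) / 2) - ↑((a + b + j) / 2) : ℤ) = (((d + i - a) / 2 : ℕ) : ℤ) by omega, qBr_klP_natCast]
  have cE2 : qBr (klP k) (↑((a + c + i + j) / 2) - ↑((c + d + j) / 2) + 1) = (qInt k ((a + i - d) / 2 + 1) : ℂ) := by
    rw [show (↑((a + c + i + j) / 2) - ↑((c + d + j) / 2) + 1 : ℤ) = (((a + i - d) / 2 + 1 : ℕ) : ℤ) by omega, qBr_klP_natCast]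
  have cD1 : qBr (klP k) (↑((b + d + i + j) / 2) - ↑((a + d + i) / 2) + 1) = (qInt k ((b + j - a) / 2 + 1) : ℂ) := by
    rw [show (↑((b + d + i + j) / 2) - ↑((a + d + i) / 2) + 1 : ℤ) = (((b + j - a) / 2 + 1 : ℕ) : ℤ) by omega, qBr_klP_natCast]
  have cD2 : qBr (klP k) (↑((b + d + i + j) / 2) - ↑((b + c + i) / 2) + 1) = (qInt k ((d + j - c) / 2 + 1) : ℂ) := by
    rw [show (↑((b + d + i + j) / 2) - ↑((b + c + i) / 2) + 1 : ℤ) = (((d + j - c) / 2 + 1 : ℕ) : ℤ) by omega, qBr_klP_natCast]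
  have cD3 : qBr (klP k) (↑((a + c + i + j) / 2) - ↑((a + d + i) / 2) + 1) = (qInt k ((c + j - d) / 2 + 1) : ℂ) := by
    rw [show (↑((a + c + i + j) / 2) - ↑((a + d + i) / 2) + 1 : ℤ) = (((c + j - d) / 2 + 1 : ℕ) : ℤ) by omega, qBr_klP_natCast]
  have cD4 : qBr (klP k) (↑((a + c + i + j) / 2) - ↑((b + c + i) / 2) + 1) = (qInt k ((a + j - b) / 2 + 1) : ℂ) := by
    rw [show (↑((a + c + i + j) / 2) - ↑((b + c + i) / 2) + 1 : ℤ) = (((a + j - b) / 2 + 1 : ℕ) : ℤ) by omega, qBr_klP_natCast]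
  have cA3 : qBr (klP k) (↑((a + b + c + d) / 2) - ↑((a + b + j) / 2)) = (qInt k ((c + d - j) / 2) : ℂ) := by
    rw [show (↑((a + b + c + d) / 2) - ↑((a + b + j) / 2) : ℤ) = (((c + d - j) / 2 : ℕ) : ℤ) by omega, qBr_klP_natCast]
  have cA4 : qBr (klP k) (↑((a + b + j) / 2) + 2) = (qInt k ((a + b + j) / 2 + 2) : ℂ) := by
    rw [show (↑((a + b + j) / 2) + 2 : ℤ) = (((a + b + j) / 2 + 2 : ℕ) : ℤ) by omega, qBr_klP_natCast]
  have cC1 : qBr (klP k) (↑((b + d + i + j) / 2) - ↑((a + d + i) / 2)) = (qInt k ((b + j - a) / 2) : ℂ) := by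
    rw [show (↑((b + d + i + j) / 2) - ↑((a + d + i) / 2) : ℤ) = (((b + j - a) / 2 : ℕ) : ℤ) by omega, qBr_klP_natCast]
  have cC2 : qBr (klP k) (↑((b + d + i + j) / 2) - ↑((b + c + i) / 2)) = (qInt k ((d + j - c) / 2) : ℂ) := by
    rw [show (↑((b + d + i + j) / 2) - ↑((b + c + i) / 2) : ℤ) = (((d + j - c) / 2 : ℕ) : ℤ) by omega, qBr_klP_natCast]
  have cC3 : qBr (klP k) (↑((a + b + c + d) / 2) - ↑((c + d + j) / 2) + 1) = (qInt k ((a + b - j) / 2 + 1) : ℂ) := by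
    rw [show (↑((a + b + c + d) / 2) - ↑((c + d + j) / 2) + 1 : ℤ) = (((a + b - j) / 2 + 1 : ℕ) : ℤ) by omega, qBr_klP_natCast]
  have cC4 : qBr (klP k) (↑((c + d + j) / 2) + 1) = (qInt k ((c + d + j) / 2 + 1) : ℂ) := by
    rw [show (↑((c + d + j) / 2) + 1 : ℤ) = (((c + d + j) / 2 + 1 : ℕ) : ℤ) by omega, qBr_klP_natCast]
  have cM1 : qBr (klP k) (↑((a + b + j) / 2) + 1) = (qInt k ((a + b + j) / 2 + 1) : ℂ) := by
    rw [show (↑((a + b + j) / 2) + 1 : ℤ) = (((a + b + j) / 2 + 1 : ℕ) : ℤ) by omega, qBr_klP_natCast]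
  have cM3 : qBr (klP k) (↑((a + b + c + d) / 2) - ↑((a + b + j) / 2) + 1) = (qInt k ((c + d - j) / 2 + 1) : ℂ) := by
    rw [show (↑((a + b + c + d) / 2) - ↑((a + b + j) / 2) + 1 : ℤ) = (((c + d - j) / 2 + 1 : ℕ) : ℤ) by omega, qBr_klP_natCast]
  rw [hW, hWup, hWdn, cj0, cj1, cj2, cE1, cE2, cD1, cD2, cD3, cD4, cA3, cA4, cC1, cC2, cC3, cC4, cM1, cM3] at key
  exact_mod_cast key


/-! ### The recurrence in coefficient form, including the corner rows `j = 0` and `j = k` -/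

/-- `[0] = 0`. [folklore] -/
@[simp] theorem qInt_zero : qInt k 0 = 0 := by simp [qInt]

/-- `sin θ ≠ 0` for `θ = π/(k+2)`. [folklore] -/
theorem sin_klAngle_ne_zero : Real.sin (Real.pi / (k + 2)) ≠ 0 := by
  have hk : (0 : ℝ) < k + 2 := by positivity
  refine (Real.sin_pos_of_pos_of_lt_pi (by positivity) ?_).ne'
  rw [div_lt_iff₀ hk]; nlinarith [Real.pi_pos]

/-- `[k+2] = 0` (`sin π = 0`): the level truncation. [cite: KauffmanLins1994, §9.8 (Δ_{r-1} = 0)] -/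
theorem qInt_level : qInt k (k + 2) = 0 := by
  unfold qInt
  have hk : ((k : ℝ) + 2) ≠ 0 := by positivity
  rw [show (((k + 2 : ℕ)) : ℝ) * Real.pi / (k + 2) = Real.pi by push_cast; field_simp, Real.sin_pi, zero_div]

/-- `[n] ≠ 0` for `1 ≤ n ≤ k+1`. [folklore] -/
theorem qInt_ne_zero {n : ℕ} (h1 : 1 ≤ n) (h2 : n ≤ k + 1) : qInt k n ≠ 0 := (qInt_pos k h1 h2).ne'

/-- The eigenvalue `E_i = [(d+i-a)/2][(a+i-d)/2+1]` of the `j`-recurrence (a function of the row `i`).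
[cite: GasperRahman2004, §7.2 eq. (7.2.1), (7.2.9)] -/
def racahE (a d i : ℕ) : ℝ := qInt k ((d + i - a) / 2) * qInt k ((a + i - d) / 2 + 1)

/-- The coefficient `D_j = [(b+j-a)/2+1][(d+j-c)/2+1][(c+j-d)/2+1][(a+j-b)/2+1]/([j+1][j+2])` of `S(j+2)`
(it is `0` by the junk value `x/0 = 0` exactly in the corner `j = k`, where `S(j+2)` is absent). [folklore] -/
def racahDco (a b c d j : ℕ) : ℝ :=
  qInt k ((b + j - a) / 2 + 1) * qInt k ((d + j - c) / 2 + 1) * qInt k ((c + j - d) / 2 + 1) *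
      qInt k ((a + j - b) / 2 + 1) / (qInt k (j + 1) * qInt k (j + 2))

/-- The coefficient `C_j = [(a+b+j)/2+1][(c+d+j)/2+1][(c+d-j)/2+1][(a+b-j)/2+1]/([j][j+1])` of `S(j-2)`
(`0` by the junk value in the corner `j = 0`, where `S(j-2)` is absent). [folklore] -/
def racahCco (a b c d j : ℕ) : ℝ :=
  qInt k ((a + b + j) / 2 + 1) * qInt k ((c + d + j) / 2 + 1) * qInt k ((c + d - j) / 2 + 1) *
      qInt k ((a + b - j) / 2 + 1) / (qInt k j * qInt k (j + 1))

/-- The diagonal coefficient `B_j = Â_j/([j+1][j+2]) + Ĉ_j/([j][j+1])` (in the corners `j = 0`, `j = k` one of the two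
terms is the junk value `x/0 = 0`, which is the correct value there). [folklore] -/
def racahBco (a b c d j : ℕ) : ℝ :=
  qInt k ((c + j - d) / 2 + 1) * qInt k ((a + j - b) / 2 + 1) * qInt k ((c + d - j) / 2) *
        qInt k ((a + b + j) / 2 + 2) / (qInt k (j + 1) * qInt k (j + 2)) +
    qInt k ((b + j - a) / 2) * qInt k ((d + j - c) / 2) * qInt k ((a + b - j) / 2 + 1) *
        qInt k ((c + d + j) / 2 + 1) / (qInt k j * qInt k (j + 1))

/-- The recurrence in coefficient form for an interior row `1 ≤ j ≤ k-1`. [cite: GasperRahman2004, §7.2 eq. (7.2.1)] -/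
theorem racahSum_rel_of_lt {a b c d i j : ℕ} (hadi : Adm k a d i) (hbci : Adm k b c i) (habj : Adm k a b j)
    (hcdj : Adm k c d j) (hj1 : 1 ≤ j) (hjk : j + 1 ≤ k) :
    racahE k a d i * racahSum k a b j c d i =
      racahDco k a b c d j * racahSumUp k a b c d i j + racahBco k a b c d j * racahSum k a b j c d i +
        racahCco k a b c d j * racahSumDown k a b c d i j := by
  have M := racahSum_threeTerm k hadi hbci habj hcdj
  have h0 : qInt k j ≠ 0 := qInt_ne_zero k hj1 (by omega)
  have h1 : qInt k (j + 1) ≠ 0 := qInt_ne_zero k (by omega) (by omega)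
  have h2 : qInt k (j + 2) ≠ 0 := qInt_ne_zero k (by omega) (by omega)
  unfold racahE racahDco racahBco racahCco
  have e : qInt k ((d + i - a) / 2) * qInt k ((a + i - d) / 2 + 1) * racahSum k a b j c d i =
      (qInt k j * qInt k (j + 1) * qInt k (j + 2))⁻¹ *
        (qInt k j * qInt k (j + 1) * qInt k (j + 2) * (qInt k ((d + i - a) / 2) * qInt k ((a + i - d) / 2 + 1)) *
          racahSum k a b j c d i) := by
    field_simp
  rw [e, M]
  field_simp

/-- `1/[0]! = 1`. [folklore] -/
theorem qInvFac_zero' {K : Type*} [Field K] (p : K) : qInvFac p 0 = 1 := by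
  simp [qInvFac, qFac]

/-- `1/[1]! = 1` when `[1] = 1`. [folklore] -/
theorem qInvFac_one' {K : Type*} [Field K] (p : K) (h : qBr p 1 = 1) : qInvFac p 1 = 1 := by
  simp [qInvFac, qFac, h]

/-- `[1] = 1` at `p = e^{iπ/(k+2)}`. [folklore] -/
theorem qBr_klP_one : qBr (klP k) 1 = 1 := by
  have h := qBr_klP_natCast k 1
  rw [qInt_one, Complex.ofReal_one, Nat.cast_one] at h
  exact h

/-- `p - p⁻¹ ≠ 0` at `p = e^{iπ/(k+2)}` (`sin θ ≠ 0`). [folklore] -/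
theorem klP_sub_inv_ne_zero : klP k - (klP k)⁻¹ ≠ 0 := by
  intro h
  have := qBr_klP_one k
  unfold qBr at this
  rw [zpow_one, zpow_neg, zpow_one, h, div_zero] at this
  exact zero_ne_one this

set_option maxHeartbeats 1600000 in
/-- The corner row `j = 0` (forcing `a = b`, `c = d`): `E_i S(0) = D_0 S(2) + B_0 S(0)` with `D_0 = 1/[2]`,
`B_0 = [c][a+2]/[2]`, i.e. the bracket identity `[2][m-a][m-c+1] = [m-a][m-c] - [m+2][a+c-m] + [c][a+2]`
(`m = (a+c+i)/2`) on the one- and two-term sums. [folklore] -/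
theorem racahSum_rel_zero (hk : 1 ≤ k) {a c i : ℕ} (hadi : Adm k a c i) :
    racahE k a c i * racahSum k a a 0 c c i =
      racahDco k a a c c 0 * racahSumUp k a a c c i 0 + racahBco k a a c c 0 * racahSum k a a 0 c c i +
        racahCco k a a c c 0 * racahSumDown k a a c c i 0 := by
  have hadi' := hadi
  unfold Adm at hadi'
  -- real simplifications of the coefficients
  have h2 : qInt k 2 ≠ 0 := qInt_ne_zero k (by omega) (by omega)
  have hD : racahDco k a a c c 0 = (qInt k 2)⁻¹ := by
    unfold racahDco
    rw [show (a + 0 - a) / 2 + 1 = 1 by omega, show (c + 0 - c) / 2 + 1 = 1 by omega, qInt_one]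
    simp
  have hB : racahBco k a a c c 0 = qInt k c * qInt k (a + 2) / qInt k 2 := by
    unfold racahBco
    rw [show (c + 0 - c) / 2 + 1 = 1 by omega, show (a + 0 - a) / 2 + 1 = 1 by omega, show (c + c - 0) / 2 = c by omega,
      show (a + a + 0) / 2 + 2 = a + 2 by omega, show (a + 0 - a) / 2 = 0 by omega, qInt_one, qInt_zero]
    simp
  have hDn : racahSumDown k a a c c i 0 = 0 := by
    unfold racahSumDown; rw [if_neg (by omega)]
  rw [hD, hB, hDn, mul_zero, add_zero]
  -- pass to `ℂ` and to the window sums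
  set m := (a + c + i) / 2 with hm
  have hma : a ≤ m := by omega
  have hmc : c ≤ m := by omega
  have hmac : m ≤ a + c := by omega
  have hlev : m ≤ k := by omega
  apply Complex.ofReal_injective
  have hS := racahSum_eq_racahW k a a c c i 0
  have hU := racahSum_eq_racahW k a a c c i 2
  rw [show (a + c + i) / 2 = m from rfl, show (a + a + 0) / 2 = a by omega, show (c + c + 0) / 2 = c by omega,
    show (a + c + i + 0) / 2 = m by omega, show (a + a + c + c) / 2 = a + c by omega] at hS
  rw [show (a + c + i) / 2 = m from rfl, show (a + a + 2) / 2 = a + 1 by omega, show (c + c + 2) / 2 = c + 1 by omega,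
    show (a + c + i + 2) / 2 = m + 1 by omega, show (a + a + c + c) / 2 = a + c by omega] at hU
  set p := klP k with hp
  have hbr : ∀ m' : ℤ, 1 ≤ m' → m' ≤ (k : ℤ) + 1 → qBr p m' ≠ 0 := fun m' h1 h2 => qBr_klP_ne_zero k h1 h2
  -- the window sums have one resp. two terms
  have hW : racahW p m m a c m m ((a + c : ℕ) : ℤ) m (a + c + 1 - m) = racahTerm p m m a c m m ((a + c : ℕ) : ℤ) m := by
    unfold racahW
    rw [sum_eq_single 0]
    · simp
    · intro n _ hn
      exact racahTerm_eq_zero_of_gt _ (Or.inl (by omega))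
    · intro h; exact absurd (mem_range.mpr (by omega)) h
  have hWup : racahW p m m ((a + 1 : ℕ) : ℤ) ((c + 1 : ℕ) : ℤ) ((m + 1 : ℕ) : ℤ) ((m + 1 : ℕ) : ℤ) ((a + c : ℕ) : ℤ) m
        (a + c + 1 - m) =
      racahTerm p m m ((a + 1 : ℕ) : ℤ) ((c + 1 : ℕ) : ℤ) ((m + 1 : ℕ) : ℤ) ((m + 1 : ℕ) : ℤ) ((a + c : ℕ) : ℤ) m +
        racahTerm p m m ((a + 1 : ℕ) : ℤ) ((c + 1 : ℕ) : ℤ) ((m + 1 : ℕ) : ℤ) ((m + 1 : ℕ) : ℤ) ((a + c : ℕ) : ℤ)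
          ((m : ℤ) + 1) := by
    unfold racahW
    by_cases htop : m + 1 ≤ a + c
    · rw [← sum_subset (s₁ := range 2) (fun n hn => by rw [mem_range] at hn ⊢; omega)]
      · simp [sum_range_succ]
      · intro n hn h2
        rw [mem_range] at hn h2
        exact racahTerm_eq_zero_of_gt _ (Or.inl (by push_cast; omega))
    · have hN : a + c + 1 - m = 1 := by omega
      rw [hN, sum_range_one, racahTerm_eq_zero_of_gt p (z := (m : ℤ) + 1) (Or.inr (Or.inr (by push_cast; omega)))]
      simp
  -- the three terms against the common core `D = (-1)^m [m+1]! (1/[m-a]!)(1/[m-c]!)(1/[a+c-m]!)`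
  set D := (-1 : ℂ) ^ (m : ℤ) * qFac p (m + 1) * qInvFac p ((m : ℤ) - a) * qInvFac p ((m : ℤ) - c) *
    qInvFac p ((a : ℤ) + c - m) with hDdef
  have h10 : qInvFac p 0 = 1 := qInvFac_zero' p
  have h11 : qInvFac p 1 = 1 := qInvFac_one' p (qBr_klP_one k)
  have t0 : racahTerm p m m a c m m ((a + c : ℕ) : ℤ) m = D := by
    unfold racahTerm
    rw [sub_self, show ((m : ℤ) + 1).toNat = m + 1 by omega, h10]
    push_cast
    ring
  have t1 : racahTerm p m m ((a + 1 : ℕ) : ℤ) ((c + 1 : ℕ) : ℤ) ((m + 1 : ℕ) : ℤ) ((m + 1 : ℕ) : ℤ) ((a + c : ℕ) : ℤ) m =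
      D * (qBr p ((m : ℤ) - a) * qBr p ((m : ℤ) - c)) := by
    unfold racahTerm
    rw [show ((m : ℤ) + 1).toNat = m + 1 by omega, sub_self, h10,
      show (m : ℤ) - ((a + 1 : ℕ) : ℤ) = ((m : ℤ) - a) - 1 by push_cast; ring, qInvFac_sub_one p hbr (by omega),
      show (m : ℤ) - ((c + 1 : ℕ) : ℤ) = ((m : ℤ) - c) - 1 by push_cast; ring, qInvFac_sub_one p hbr (by omega),
      show ((m + 1 : ℕ) : ℤ) - m = 1 by push_cast; ring, h11,
      show ((a + c : ℕ) : ℤ) - m = (a : ℤ) + c - m by push_cast; ring, hDdef]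
    ring
  have t2 : racahTerm p m m ((a + 1 : ℕ) : ℤ) ((c + 1 : ℕ) : ℤ) ((m + 1 : ℕ) : ℤ) ((m + 1 : ℕ) : ℤ) ((a + c : ℕ) : ℤ)
      ((m : ℤ) + 1) = -(D * (qBr p ((m : ℤ) + 2) * qBr p ((a : ℤ) + c - m))) := by
    unfold racahTerm
    have hneg : (-1 : ℂ) ≠ 0 := neg_ne_zero.mpr one_ne_zero
    rw [show ((m : ℤ) + 1 + 1).toNat = (m + 1) + 1 by omega, qFac_succ, zpow_add₀ hneg, zpow_one,
      show (((m + 1 : ℕ) : ℕ) : ℤ) + 1 = (m : ℤ) + 2 by push_cast; ring,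
      show (m : ℤ) + 1 - m = 1 by ring, h11, show (m : ℤ) + 1 - ((a + 1 : ℕ) : ℤ) = (m : ℤ) - a by push_cast; ring,
      show (m : ℤ) + 1 - ((c + 1 : ℕ) : ℤ) = (m : ℤ) - c by push_cast; ring,
      show ((m + 1 : ℕ) : ℤ) - ((m : ℤ) + 1) = 0 by push_cast; ring, h10,
      show ((a + c : ℕ) : ℤ) - ((m : ℤ) + 1) = ((a : ℤ) + c - m) - 1 by push_cast; ring,
      qInvFac_sub_one p hbr (by omega), hDdef]
    ring
  -- the bracket identity `[2][m-a][m-c+1] = [m-a][m-c] - [m+2][a+c-m] + [c][a+2]`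
  have hp0 : p ≠ 0 := klP_ne_zero k
  have hw : p - p⁻¹ ≠ 0 := klP_sub_inv_ne_zero k
  have key : qBr p 2 * qBr p ((m : ℤ) - a) * qBr p ((m : ℤ) - c + 1) =
      qBr p ((m : ℤ) - a) * qBr p ((m : ℤ) - c) - qBr p ((m : ℤ) + 2) * qBr p ((a : ℤ) + c - m) +
        qBr p c * qBr p ((a : ℤ) + 2) := by
    have hPm : p ^ (m : ℤ) ≠ 0 := zpow_ne_zero _ hp0
    have hPa : p ^ (a : ℤ) ≠ 0 := zpow_ne_zero _ hp0
    have hPc : p ^ (c : ℤ) ≠ 0 := zpow_ne_zero _ hp0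
    have hw2 : p ^ 2 - 1 ≠ 0 := by
      intro h; apply hw
      have : p - p⁻¹ = (p ^ 2 - 1) / p := by field_simp
      rw [this, h, zero_div]
    simp only [qBr, zpow_add₀ hp0, zpow_sub₀ hp0, zpow_neg, zpow_ofNat, zpow_natCast]
    field_simp
    ring
  -- assemble
  have eE : (racahE k a c i : ℂ) = qBr p ((m : ℤ) - a) * qBr p ((m : ℤ) - c + 1) := by
    unfold racahE
    push_cast
    rw [show ((m : ℤ) - a) = (((c + i - a) / 2 : ℕ) : ℤ) by omega,
      show ((m : ℤ) - c + 1) = (((a + i - c) / 2 + 1 : ℕ) : ℤ) by omega, qBr_klP_natCast, qBr_klP_natCast]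
  have e2 : (qInt k 2 : ℂ) = qBr p 2 := by exact_mod_cast (qBr_klP_natCast k 2).symm
  have ec : (qInt k c : ℂ) = qBr p c := by exact_mod_cast (qBr_klP_natCast k c).symm
  have ea : (qInt k (a + 2) : ℂ) = qBr p ((a : ℤ) + 2) := by exact_mod_cast (qBr_klP_natCast k (a + 2)).symm
  have hUp : (racahSumUp k a a c c i 0 : ℂ) = racahW p m m ((a + 1 : ℕ) : ℤ) ((c + 1 : ℕ) : ℤ) ((m + 1 : ℕ) : ℤ)
      ((m + 1 : ℕ) : ℤ) ((a + c : ℕ) : ℤ) m (a + c + 1 - m) := by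
    unfold racahSumUp
    split_ifs with h
    · rw [hU]
    · unfold Tri at h
      rw [Complex.ofReal_zero]
      rcases Nat.eq_zero_or_pos a with ha | ha
      · symm; apply racahW_eq_zero_of_lt₄; push_cast; omega
      · rcases Nat.eq_zero_or_pos c with hc | hc
        · symm; apply racahW_eq_zero_of_lt₃; push_cast; omega
        · exact absurd ⟨⟨by omega, by omega, by omega, by omega⟩, ⟨by omega, by omega, by omega, by omega⟩⟩ h
  have h2' : qBr p 2 ≠ 0 := by rw [← e2]; exact_mod_cast h2
  push_cast
  rw [hS, hUp, hW, hWup, t0, t1, t2, eE, e2, ec, ea]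
  field_simp
  linear_combination D * key


set_option maxHeartbeats 1600000 in
/-- The corner row `j = k` (forcing `a + b = c + d = k`): `E_i S(k) = B_k S(k) + C_k S(k-2)` with
`B_k = [(b+k-a)/2][(d+k-c)/2]/[k]`, `C_k = [k+1]/[k]`, i.e. the bracket identity
`[k][β₁-k][β₂-k+1] = [β₁-α₁][β₁-α₂] + [k+1][β₁-k][β₂-k] - [k-α₁][k-α₂]` (`β₂ = α₁+α₂+k-β₁`) on the one- and
two-term sums. [folklore] -/
theorem racahSum_rel_top (hk : 1 ≤ k) {a b c d i : ℕ} (hadi : Adm k a d i) (hbci : Adm k b c i) (habj : Adm k a b k)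
    (hcdj : Adm k c d k) :
    racahE k a d i * racahSum k a b k c d i =
      racahDco k a b c d k * racahSumUp k a b c d i k + racahBco k a b c d k * racahSum k a b k c d i +
        racahCco k a b c d k * racahSumDown k a b c d i k := by
  have hadi' := hadi; have hbci' := hbci; have habj' := habj; have hcdj' := hcdj
  unfold Adm at hadi' hbci' habj' hcdj'
  have hab : a + b = k := by omega
  have hcd : c + d = k := by omega
  -- real simplifications of the coefficients
  have hk0 : qInt k k ≠ 0 := qInt_ne_zero k hk (by omega)
  have hk1 : qInt k (k + 1) ≠ 0 := qInt_ne_zero k (by omega) (by omega)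
  have hD : racahDco k a b c d k = 0 := by
    unfold racahDco; rw [qInt_level, mul_zero, div_zero]
  have hB : racahBco k a b c d k = qInt k ((b + k - a) / 2) * qInt k ((d + k - c) / 2) * qInt k (k + 1) /
      (qInt k k * qInt k (k + 1)) := by
    unfold racahBco
    rw [show (c + d - k) / 2 = 0 by omega, qInt_zero, mul_zero, zero_mul, zero_div, zero_add,
      show (a + b - k) / 2 + 1 = 1 by omega, qInt_one, mul_one, show (c + d + k) / 2 + 1 = k + 1 by omega]
  have hC : racahCco k a b c d k = qInt k (k + 1) * qInt k (k + 1) / (qInt k k * qInt k (k + 1)) := by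
    unfold racahCco
    rw [show (a + b + k) / 2 + 1 = k + 1 by omega, show (c + d + k) / 2 + 1 = k + 1 by omega,
      show (c + d - k) / 2 + 1 = 1 by omega, show (a + b - k) / 2 + 1 = 1 by omega, qInt_one, mul_one, mul_one]
  rw [hD, hB, hC, zero_mul, zero_add]
  -- pass to `ℂ` and to the window sums
  set α₁ := (a + d + i) / 2 with hα₁
  set α₂ := (b + c + i) / 2 with hα₂
  set β₁ := (b + d + i + k) / 2 with hβ₁
  set β₂ := (a + c + i + k) / 2 with hβ₂
  have hbal : β₁ + β₂ = α₁ + α₂ + k := by omega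
  have hα₁k : α₁ ≤ k := by omega
  have hα₂k : α₂ ≤ k := by omega
  have hβ₁k : k ≤ β₁ := by omega
  have hβ₂k : k ≤ β₂ := by omega
  have hβ₁' : β₁ ≤ 2 * k := by omega
  have hβ₂' : β₂ ≤ 2 * k := by omega
  apply Complex.ofReal_injective
  have hS := racahSum_eq_racahW k a b c d i k
  have hDn := racahSumDown_coe k ((adm_iff_tri k).mp hadi).1 ((adm_iff_tri k).mp hbci).1 ((adm_iff_tri k).mp habj).1
    ((adm_iff_tri k).mp hcdj).1 (i := i)
  rw [show (a + d + i) / 2 = α₁ from rfl, show (b + c + i) / 2 = α₂ from rfl, show (a + b + k) / 2 = k by omega,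
    show (c + d + k) / 2 = k by omega, show (b + d + i + k) / 2 = β₁ from rfl, show (a + c + i + k) / 2 = β₂ from rfl,
    show (a + b + c + d) / 2 = k by omega] at hS hDn
  set p := klP k with hp
  have hbr : ∀ m' : ℤ, 1 ≤ m' → m' ≤ (k : ℤ) + 1 → qBr p m' ≠ 0 := fun m' h1 h2 => qBr_klP_ne_zero k h1 h2
  -- the window sums: one term (`z = k`) resp. two terms (`z = k-1, k`)
  have hW : racahW p α₁ α₂ k k β₁ β₂ k α₁ (k + 1 - α₁) = racahTerm p α₁ α₂ k k β₁ β₂ k k := by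
    unfold racahW
    rw [sum_eq_single (k - α₁)]
    · congr 1; omega
    · intro n hn hne
      rw [mem_range] at hn
      exact racahTerm_eq_zero_of_lt _ (Or.inr (Or.inr (Or.inl (by omega))))
    · intro h; exact absurd (mem_range.mpr (by omega)) h
  have hWdn : racahW p α₁ α₂ ((k : ℤ) - 1) ((k : ℤ) - 1) ((β₁ : ℤ) - 1) ((β₂ : ℤ) - 1) k α₁ (k + 1 - α₁) =
      racahTerm p α₁ α₂ ((k : ℤ) - 1) ((k : ℤ) - 1) ((β₁ : ℤ) - 1) ((β₂ : ℤ) - 1) k ((k : ℤ) - 1) +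
        racahTerm p α₁ α₂ ((k : ℤ) - 1) ((k : ℤ) - 1) ((β₁ : ℤ) - 1) ((β₂ : ℤ) - 1) k k := by
    unfold racahW
    by_cases hlow : α₁ + 1 ≤ k
    · rw [sum_eq_add (k - 1 - α₁) (k - α₁) (by omega)]
      · congr 2 <;> omega
      · intro n hn hne
        rw [mem_range] at hn
        exact racahTerm_eq_zero_of_lt _ (Or.inr (Or.inr (Or.inl (by omega))))
      · intro h; exact absurd (mem_range.mpr (by omega)) h
      · intro h; exact absurd (mem_range.mpr (by omega)) h
    · have hαk : α₁ = k := by omega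
      rw [show k + 1 - α₁ = 1 by omega, sum_range_one,
        racahTerm_eq_zero_of_lt p (z := (k : ℤ) - 1) (Or.inl (by omega)), zero_add]
      congr 1; omega
  -- the three terms against the common core `D = (-1)^k [k]! (1/[k-α₁]!)(1/[k-α₂]!)(1/[β₁-k]!)(1/[β₂-k]!)`
  set D := (-1 : ℂ) ^ (k : ℤ) * qFac p k * qInvFac p ((k : ℤ) - α₁) * qInvFac p ((k : ℤ) - α₂) *
    qInvFac p ((β₁ : ℤ) - k) * qInvFac p ((β₂ : ℤ) - k) with hDdef
  have h10 : qInvFac p 0 = 1 := qInvFac_zero' p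
  have h11 : qInvFac p 1 = 1 := qInvFac_one' p (qBr_klP_one k)
  have hneg : (-1 : ℂ) ≠ 0 := neg_ne_zero.mpr one_ne_zero
  have t0 : racahTerm p α₁ α₂ k k β₁ β₂ k k = D * qBr p ((k : ℤ) + 1) := by
    unfold racahTerm
    rw [show ((k : ℤ) + 1).toNat = k + 1 by omega, qFac_succ, sub_self, h10, hDdef]
    ring
  have t1 : racahTerm p α₁ α₂ ((k : ℤ) - 1) ((k : ℤ) - 1) ((β₁ : ℤ) - 1) ((β₂ : ℤ) - 1) k k =
      D * qBr p ((k : ℤ) + 1) * (qBr p ((β₁ : ℤ) - k) * qBr p ((β₂ : ℤ) - k)) := by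
    unfold racahTerm
    rw [show ((k : ℤ) + 1).toNat = k + 1 by omega, qFac_succ, show (k : ℤ) - ((k : ℤ) - 1) = 1 by ring, h11,
      sub_self, h10, show (β₁ : ℤ) - 1 - k = ((β₁ : ℤ) - k) - 1 by ring, qInvFac_sub_one p hbr (by omega),
      show (β₂ : ℤ) - 1 - k = ((β₂ : ℤ) - k) - 1 by ring, qInvFac_sub_one p hbr (by omega), hDdef]
    ring
  have t2 : racahTerm p α₁ α₂ ((k : ℤ) - 1) ((k : ℤ) - 1) ((β₁ : ℤ) - 1) ((β₂ : ℤ) - 1) k ((k : ℤ) - 1) =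
      -(D * (qBr p ((k : ℤ) - α₁) * qBr p ((k : ℤ) - α₂))) := by
    unfold racahTerm
    rw [show ((k : ℤ) - 1 + 1).toNat = k by omega, sub_self, h10,
      show (k : ℤ) - 1 - α₁ = ((k : ℤ) - α₁) - 1 by ring, qInvFac_sub_one p hbr (by omega),
      show (k : ℤ) - 1 - α₂ = ((k : ℤ) - α₂) - 1 by ring, qInvFac_sub_one p hbr (by omega),
      show (β₁ : ℤ) - 1 - (k - 1) = (β₁ : ℤ) - k by ring, show (β₂ : ℤ) - 1 - (k - 1) = (β₂ : ℤ) - k by ring,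
      show (k : ℤ) - (k - 1) = 1 by ring, h11, show (k : ℤ) - 1 = (k : ℤ) + (-1) by ring, zpow_add₀ hneg,
      zpow_neg_one, hDdef]
    ring
  -- the bracket identity
  have hp0 : p ≠ 0 := klP_ne_zero k
  have hw : p - p⁻¹ ≠ 0 := klP_sub_inv_ne_zero k
  have key : qBr p k * qBr p ((β₁ : ℤ) - k) * qBr p ((β₂ : ℤ) - k + 1) =
      qBr p ((β₁ : ℤ) - α₁) * qBr p ((β₁ : ℤ) - α₂) + qBr p ((k : ℤ) + 1) * qBr p ((β₁ : ℤ) - k) * qBr p ((β₂ : ℤ) - k) -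
        qBr p ((k : ℤ) - α₁) * qBr p ((k : ℤ) - α₂) := by
    have hB2 : (β₂ : ℤ) = (α₁ : ℤ) + α₂ + k - β₁ := by omega
    rw [hB2]
    have hP1 : p ^ (α₁ : ℤ) ≠ 0 := zpow_ne_zero _ hp0
    have hP2 : p ^ (α₂ : ℤ) ≠ 0 := zpow_ne_zero _ hp0
    have hP3 : p ^ (β₁ : ℤ) ≠ 0 := zpow_ne_zero _ hp0
    have hP4 : p ^ (k : ℤ) ≠ 0 := zpow_ne_zero _ hp0
    have hw2 : p ^ 2 - 1 ≠ 0 := by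
      intro h; apply hw
      have : p - p⁻¹ = (p ^ 2 - 1) / p := by field_simp
      rw [this, h, zero_div]
    simp only [qBr, zpow_add₀ hp0, zpow_sub₀ hp0, zpow_neg, zpow_ofNat, zpow_natCast]
    field_simp
    ring
  -- assemble
  have eE : (racahE k a d i : ℂ) = qBr p ((β₁ : ℤ) - k) * qBr p ((β₂ : ℤ) - k + 1) := by
    unfold racahE
    push_cast
    rw [show ((β₁ : ℤ) - k) = (((d + i - a) / 2 : ℕ) : ℤ) by omega,
      show ((β₂ : ℤ) - k + 1) = (((a + i - d) / 2 + 1 : ℕ) : ℤ) by omega, qBr_klP_natCast, qBr_klP_natCast]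
  have e1 : (qInt k ((b + k - a) / 2) : ℂ) = qBr p ((β₁ : ℤ) - α₁) := by
    rw [show ((β₁ : ℤ) - α₁) = (((b + k - a) / 2 : ℕ) : ℤ) by omega]; exact_mod_cast (qBr_klP_natCast k _).symm
  have e2 : (qInt k ((d + k - c) / 2) : ℂ) = qBr p ((β₁ : ℤ) - α₂) := by
    rw [show ((β₁ : ℤ) - α₂) = (((d + k - c) / 2 : ℕ) : ℤ) by omega]; exact_mod_cast (qBr_klP_natCast k _).symm
  have ek : (qInt k k : ℂ) = qBr p k := by exact_mod_cast (qBr_klP_natCast k k).symm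
  have ek1 : (qInt k (k + 1) : ℂ) = qBr p ((k : ℤ) + 1) := by exact_mod_cast (qBr_klP_natCast k (k + 1)).symm
  have hk0' : qBr p k ≠ 0 := by rw [← ek]; exact_mod_cast hk0
  have hk1' : qBr p ((k : ℤ) + 1) ≠ 0 := by rw [← ek1]; exact_mod_cast hk1
  push_cast
  rw [hS, hDn, hW, hWdn, t0, t1, t2, eE, e1, e2, ek, ek1]
  field_simp
  linear_combination D * key


/-- **The `j`-recurrence of the Kauffman–Lins Racah sum in coefficient form, all rows** (`k ≥ 1`): for level-`k`
admissible `(a,d,i), (b,c,i), (a,b,j), (c,d,j)`,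
`E_i·S(j) = D_j·S(j+2) + B_j·S(j) + C_j·S(j-2)` with `S(j±2)` the guarded neighbours `racahSumUp/Down`.
[cite: GasperRahman2004, §7.2 eq. (7.2.1)] [cite: KauffmanLins1994, §9.11] -/
theorem racahSum_rel (hk : 1 ≤ k) {a b c d i j : ℕ} (hadi : Adm k a d i) (hbci : Adm k b c i) (habj : Adm k a b j)
    (hcdj : Adm k c d j) :
    racahE k a d i * racahSum k a b j c d i =
      racahDco k a b c d j * racahSumUp k a b c d i j + racahBco k a b c d j * racahSum k a b j c d i +
        racahCco k a b c d j * racahSumDown k a b c d i j := by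
  rcases Nat.eq_zero_or_pos j with h0 | h0
  · subst h0
    have hab : b = a := ((adm_zero_right k (by unfold Adm at habj; omega)).mp habj)
    have hcd : d = c := ((adm_zero_right k (by unfold Adm at hcdj; omega)).mp hcdj)
    subst hab hcd
    exact racahSum_rel_zero k hk hadi
  · by_cases htop : j + 1 ≤ k
    · exact racahSum_rel_of_lt k hadi hbci habj hcdj h0 htop
    · have hj : k = j := by unfold Adm at habj; omega
      obtain rfl := hj
      exact racahSum_rel_top k hk hadi hbci habj hcdj

end Literature.RepresentationTheory.ModularTensorCategories.SU2LevelK
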